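import Summits.AtomisticToContinuum.Crystallization.Theorems.ChartedZeroExcessLayeredLatticeLiouvilleB

/-!
# ChartedZeroExcessLayered · LatticeLiouville — part C/8: §C the upward skeleton, §C′ N″ re-targeted, §C″ N″(Λ, θ) (decomp-a2c lens-2 g24 `LatticeLiouville.lean` v8 sha256 4defadc6…, lines 687–843,
split at the `##` / `###` doc-heading boundaries for the gate's 400-line limit (cut table of critic row 444, §C cut once more at §C‴); content byte-identical; ONE
namespace `…Theorems.ChartedZeroExcessLayeredLatticeLiouville` across the parts, linear import chain.
-/

noncomputable section

open scoped BigOperators InnerProductSpace RealInnerProductSpace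
open MeasureTheory Set Metric
open Summit.AtomisticToContinuum.Crystallization.Theorems.ChartedPlanarOrderRigidityDoor (E3 IsClean IsNash IsCharted VisibleGap PertRegime atomsIn)
open Summit.AtomisticToContinuum.Crystallization.Theorems.ChartedPlanarOrderDensityDichotomy (μS IsSep)
open Summit.AtomisticToContinuum.Crystallization.Theorems.ChartedPlanarOrderMesoCut (IsDoorSet NearHom LayeredHom EnvClose)
open Summit.AtomisticToContinuum.Crystallization.Theorems.OverbindingBudgetLiouvilleDictionary (NearHomBD nearHom_of_nearHomBD)
open Summit.AtomisticToContinuum.Crystallization.Theorems.ChartedPlanarOrderDoorLayered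
  (TwoPeriodic not_twoPeriodic_singleton DoorHomogeneityBD DoorPeriodic PeriodicBulkGapDoor PeriodicBulkGap
   doorPeriodic_of_doorHomogeneityBD gap_and_pert_1_50_of_periodic gap_and_pert_1_50_of_periodic'
   NearHomL2BD CleanScaleCoherenceL2BD FlatnessExactL2BD doorPeriodic_of_L2 cleanScaleCoherenceL2BD_of_large nearHomL2BD_mono Layered)
open Summit.AtomisticToContinuum.Crystallization.Theorems.ChartedPlanarOrderDoorLayeredOsc
  (IsTwoShellAffineGood OscillationImprovement DoorPeriodicOsc doorPeriodic_of_osc doorPeriodicOsc_of_doorPeriodic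
   oscillationImprovement_of_ge)
open Literature.MathematicalPhysics.StatisticalMechanics (triangularVec₁ triangularVec₂)

namespace Summit.AtomisticToContinuum.Crystallization.Theorems.ChartedZeroExcessLayeredLatticeLiouville

/-! ## §C  The upward skeleton to L1′ — over the bounded-distortion currency OF RECORD (tree `NearHomBD`, lens-4; critic row 399 (2))

lens-4 28 (STATUS l.1888, farm-proved `nearHom_of_countable`) and the critic's ERRATUM (row 399 (1)): the tree's `NearHom τ r S Q` is
VACUOUSLY TRUE for countable `S` (degenerate chart `L = 0`), hence so is L1′ `DoorHomogeneity` AS TYPED.  Row 399 (2) fixes the repair: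
the lens-2/lens-3 column adopts lens-4's landed `NearHomBD Λ τ r S Q` (`Theorems/OverbindingBudgetLiouvilleDictionary.lean` §3: ONE
continuous linear automorphism `L` with `‖L‖ ≤ Λ`, `‖L⁻¹‖ ≤ Λ`; Λ₀ = 2), whose non-vacuity is the tree's `not_nearHomBD_singleton` and the
sibling node's scale-incoherent two-patch (`HomCoercivityBD.not_nearHomBD_twoPatch`).  This section IMPORTS that definition and defines no
nearness predicate of its own; since v6 (critic row 411 (3) rebase) it also IMPORTS L1′[BD] `DoorHomogeneityBD`, L1′♮ `DoorPeriodic`, HBG″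
`PeriodicBulkGapDoor` and §3d `doorPeriodic_of_doorHomogeneityBD` from the tree modules `…ChartedPlanarOrderDoorLayered{,Exactness}` (lens-3 g22,
hand-2 g8) and re-declares none of them (the vacuous tree-era `DoorHomogeneity` comparison target of v3–v5 is dropped). -/


/-- **N′ «NonlinearTransfer Λ»** (UNDECIDED · BRIDGE-SHAPED · lens-3's crux proper, = the engine half K_B² of lens-3 21k in Liouville
form): the linear statics Liouville theorem for clean Nash crystals implies the repaired L1′.  Schema of record (lens-3 MEMO-Liouville /
MEMO-Liouville-2; critic rows 390 (1), 395 (2)): (i) discrete geometric rigidity per root ball in L²-excess (K_A², equilibrium-free);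
(ii) Campanato excess decay for EQUILIBRIA at small excess density — linearise at the ball's own chart: the blow-down of a non-improving
sequence is a bounded-gradient harmonic field of `ljKernel A m` at a clean STABLE crystal, affine by `LatticeLiouvilleCert`, contradiction;
(iii) iterate from infinity ⇒ exactly homogeneous ⇒ a posteriori no rotation drift (F. John's spiral is killed only by the equations:
Nash-ESSENTIAL).  Quantitative inputs = TAG 138′/139′ (C_rig sub-line, contraction column).  Why it might fail: the clean oscillation
1/16 may exceed the contraction regime of the linearised LJ operator (then only a smaller-oscillation version holds); cheapest falsifier:
TAG 138′ contraction factor ≥ 1 at oscillation 1/16. -/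
def NonlinearTransfer (Λ : ℝ) : Prop := LatticeLiouvilleCert → DoorHomogeneityBD Λ

/-- **the skeleton `L1′(Λ) ⟸ L ∧ N′(Λ)`.** -/
theorem doorHomogeneityBD_of {Λ : ℝ} (hL : LatticeLiouvilleCert) (hN : NonlinearTransfer Λ) : DoorHomogeneityBD Λ := hN hL

/-- **the full chain of this node at the working literal Λ₀ = 2:
L1′[BD](2) ⟸ LJDecay ∧ LJMoments ∧ CleanCrystalStability ∧ NonlinearTransfer 2**. -/
theorem doorHomogeneityBD_of_pieces (hD : LJDecay) (hM : LJMoments) (hC : CleanCrystalStability) (hN : NonlinearTransfer 2) :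
    DoorHomogeneityBD 2 :=
  doorHomogeneityBD_of (latticeLiouvilleCert_of (latticeLinLiouville_of hD hM) hC) hN

/-! ### §C′  N″ — the transfer RE-TARGETED at the chart-free exact reading L1′♮ `DoorPeriodic Λ` (critic l.1957 ORDER «lens-2 g23/g24: state
N″ «LatticeLiouvilleCert → DoorPeriodic 2» over tree names»; row 411 (6)).  TREE names used: `DoorPeriodic`, `TwoPeriodic`, `not_twoPeriodic_singleton`,
`doorPeriodic_of_doorHomogeneityBD` (§3d, `…DoorLayeredExactness`), `PeriodicBulkGapDoor`/`PeriodicBulkGap`, `gap_and_pert_1_50_of_periodic(')`. -/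

/-- **N″ «NonlinearTransferExact Λ»** := `LatticeLiouvilleCert → DoorPeriodic Λ` (UNDECIDED · BRIDGE-SHAPED · the ONE perturbative discrete
Liouville statement at oscillation 1/16, critic l.1957: «the crux beneath L1′♮ is ONE statement = lens-2's N′ ∘ T re-targeted at DoorPeriodic Λ»).
Same schema as N′ (i)–(iii) INCLUDING the last step «⇒ exactly homogeneous» (lens-3 `FlatnessExactL2BD`); WEAKER than N′ given lens-3 §3d
(tree `doorPeriodic_of_doorHomogeneityBD : DoorHomogeneityBD Λ → DoorPeriodic Λ`, exactness by discreteness — `nonlinearTransferExact_of_nonlinearTransfer`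
below, UNCONDITIONAL since v6).  Why it might fail / cheapest falsifier: as N′ (TAG 138′ contraction ≥ 1 at
oscillation 1/16). -/
def NonlinearTransferExact (Λ : ℝ) : Prop := LatticeLiouvilleCert → DoorPeriodic Λ

/-- **N′ ⟹ N″** OUTRIGHT (tree §3d `doorPeriodic_of_doorHomogeneityBD`, lens-3 g22 / hand-2 p819164): N″ is the WEAKER transfer. -/
theorem nonlinearTransferExact_of_nonlinearTransfer {Λ : ℝ} (hN : NonlinearTransfer Λ) : NonlinearTransferExact Λ :=
  fun hL => doorPeriodic_of_doorHomogeneityBD (hN hL)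

/-- **the skeleton `L1′♮(Λ) ⟸ L ∧ N″(Λ)`.** -/
theorem doorPeriodic_of {Λ : ℝ} (hL : LatticeLiouvilleCert) (hN : NonlinearTransferExact Λ) : DoorPeriodic Λ := hN hL

/-- **the full chain at Λ₀ = 2 into the chart-free reading: L1′♮(2) ⟸ LJDecay ∧ LJMoments ∧ CleanCrystalStability ∧ N″(2)** — composes with
lens-3's `gap_and_pert_1_50_of_periodic'` / the sibling node's `HomCoercivityBD.gap_and_pert_1_50_of_exactLayered` (β column). -/
theorem doorPeriodic_of_pieces (hD : LJDecay) (hM : LJMoments) (hC : CleanCrystalStability) (hN : NonlinearTransferExact 2) : DoorPeriodic 2 :=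
  doorPeriodic_of (latticeLiouvilleCert_of (latticeLinLiouville_of hD hM) hC) hN

/-- ★ **THE (β) COLUMN OF RECORD FROM TYPED LEAVES, door DISCHARGED by name** (row 408: N column = … ∨ [DoorPeriodic Λ ∧ PeriodicBulkGapDoor Λ];
tree `gap_and_pert_1_50_of_periodic`): `LJDecay → LJMoments → CleanCrystalStability → NonlinearTransferExact 2 → PeriodicBulkGapDoor 2 →
VisibleGap (1/50) ∧ PertRegime (1/50)` — five named leaves (two TRUE·S/M, one certificate-class TAG 138′, lens-3's transfer N″, and HBG″ which is
fed by lens-2's A♭ ∧ bridge B through the sibling node's `HomCoercivityBD.periodicBulkGap_of_exactLayered` and tree `periodicBulkGapDoor_of_periodicBulkGap`). -/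
theorem gap_and_pert_1_50_of_liouville_pieces (hD : LJDecay) (hM : LJMoments) (hC : CleanCrystalStability) (hN : NonlinearTransferExact 2)
    (hG : PeriodicBulkGapDoor 2) : VisibleGap (1 / 50) ∧ PertRegime (1 / 50) :=
  gap_and_pert_1_50_of_periodic (doorPeriodic_of_pieces hD hM hC hN) hG

/-- the same with lens-3's chart-free HBG″♭ `PeriodicBulkGap 2` (tree `gap_and_pert_1_50_of_periodic'`). -/
theorem gap_and_pert_1_50_of_liouville_pieces' (hD : LJDecay) (hM : LJMoments) (hC : CleanCrystalStability) (hN : NonlinearTransferExact 2)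
    (hG : PeriodicBulkGap 2) : VisibleGap (1 / 50) ∧ PertRegime (1 / 50) :=
  gap_and_pert_1_50_of_periodic' (doorPeriodic_of_pieces hD hM hC hN) hG

/-! ### §C″  N″(Λ, θ) — the perturbative transfer WITH AN EXPLICIT OSCILLATION PARAMETER (critic row 414 (1)(d) ★ PERTURBATIVE-WINDOW FLAG:
«the perturbative discrete Liouville (lens-2 N′/N″, K_B²) is census-certified only for OSCILLATION ≤ 1/32 (fcc) / ≤ 1/16 (hcp), while N's door
tolerance is 1/16 ⇒ lens-2's N″ MUST carry an explicit oscillation parameter θ_osc and the Liouville slot gains a typed BOOTSTRAP piece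
OscillationImprovement»; standing assignment row 416 (4) «lens-2 = the perturbative transfer N″ with explicit θ_osc»).  ONE CURRENCY: every
object here is lens-3 g22's, from the TREE module `…ChartedPlanarOrderDoorLayeredOsc` (hand-2 landed; byte-identical to HOME
`decomp-a2c-lens-3/g22/OscillationBootstrap.lean` bac5c45d…): `IsTwoShellAffineGood θ Y q` (the 18-atom environment of `q` within `θ` of an
ARBITRARY affine image — `θ` bounds only the NON-AFFINE part = the strain oscillation / discrete second gradient at scale 1, the Campanato
quantity), `OscillationImprovement θ` (THE BOOTSTRAP: every door set is θ-affine-good at every atom; free for θ ≥ 1/16, content below;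
UNDECIDED · INSTRUMENTABLE TAG 154 CAMP-CLEAN), `DoorPeriodicOsc Λ θ` (the exact leaf restricted to oscillation ≤ θ) and the seam
`doorPeriodic_of_osc : DoorPeriodicOsc Λ θ → OscillationImprovement θ → DoorPeriodic Λ` — imported, not re-declared (lens-3 l.2026: «lens-2:
PLEASE type N″(Λ, θ) := LatticeLiouvilleCert → DoorPeriodicOsc Λ θ over THIS def once landed»: done here). -/

/-- **N″(Λ, θ) «NonlinearTransferOsc Λ θ»** := `LatticeLiouvilleCert → DoorPeriodicOsc Λ θ`: the linear statics Liouville certificate for clean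
stable LJ crystals implies that every door set WHOSE LOCAL STRAIN OSCILLATION IS ≤ θ (every atom `θ`-affine-good) is two-periodic with constant
`Λ`.  This is precisely what the perturbative schema (i)–(iii) of N′ can deliver: the Campanato iteration (ii) contracts only while the clamped
ball stays inside the elastic basin of the linearised operator, census-certified (LAT13 CAMP column, critic row 414 (1)(d)) for oscillation
≤ 1/32 (fcc; interior rearrangement by 1.8·a at 1/16) / ≤ 1/16 (hcp).  LITERAL OF RECORD θ_osc = 1/32.  UNDECIDED · BRIDGE-SHAPED · ANTI-MONOTONE
in θ (`NonlinearTransferOsc.anti`: smaller θ = weaker claim) · WEAKER than N″ (`nonlinearTransferOsc_of_exact`) · and for θ ≥ 1/16 literally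
⟺ N″ (`nonlinearTransferOsc_iff_exact_of_ge`: the bootstrap is free at the clean tolerance, tree `oscillationImprovement_of_ge`).
Why it might fail (at θ = 1/32, i.e. BEYOND the basin issue the parameter removes): step (iii) «iterate from infinity» needs the blow-down of a
non-improving sequence to be a GLOBAL bounded-gradient `ljKernel`-harmonic field; a door set is merely separated + clean + Nash + charted with
no boundary, but excess may fail to DECAY inward from infinity at a rate summable over dyadic scales (logarithmic failure of Campanato at the
critical L^∞-gradient endpoint in d = 3 is the classical danger; cf. the F. John spiral, killed only by the equations).  Cheapest falsifier:
census TAG 154 CAMP-CLEAN answered «YES» AND the rearranged clean non-affine fcc interior continues to an infinite clean Nash equilibrium patch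
of oscillation ≤ 1/32 (W₆ direction); in Lean, any `S` with `IsDoorSet δ S`, all atoms (1/32)-affine-good, `¬ TwoPeriodic 2 S`. -/
def NonlinearTransferOsc (Λ θ : ℝ) : Prop := LatticeLiouvilleCert → DoorPeriodicOsc Λ θ

/-- **N″ ⟹ N″(Λ, θ)** for every θ (tree `doorPeriodicOsc_of_doorPeriodic`): the θ-restricted transfer is the WEAKER statement. -/
theorem nonlinearTransferOsc_of_exact {Λ : ℝ} (hN : NonlinearTransferExact Λ) (θ : ℝ) : NonlinearTransferOsc Λ θ :=
  fun hL => doorPeriodicOsc_of_doorPeriodic (hN hL) θ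

/-- **N′ ⟹ N″(Λ, θ)** (through N″). -/
theorem nonlinearTransferOsc_of_nonlinearTransfer {Λ : ℝ} (hN : NonlinearTransfer Λ) (θ : ℝ) : NonlinearTransferOsc Λ θ :=
  nonlinearTransferOsc_of_exact (nonlinearTransferExact_of_nonlinearTransfer hN) θ

/-- **anti-monotonicity in the oscillation parameter**: a transfer valid up to oscillation `θ'` is valid up to any `θ ≤ θ'`. -/
theorem NonlinearTransferOsc.anti {Λ θ θ' : ℝ} (hθ : θ ≤ θ') (h : NonlinearTransferOsc Λ θ') : NonlinearTransferOsc Λ θ :=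
  fun hL => (h hL).anti hθ

/-- **the seam on the transfer side: N″(Λ, θ) ∧ OscillationImprovement θ ⟹ N″(Λ)** (tree `doorPeriodic_of_osc`). -/
theorem nonlinearTransferExact_of_osc {Λ θ : ℝ} (hN : NonlinearTransferOsc Λ θ) (hB : OscillationImprovement θ) :
    NonlinearTransferExact Λ :=
  fun hL => doorPeriodic_of_osc (hN hL) hB

/-- **calibration: for θ ≥ 1/16 the bootstrap is free (tree `oscillationImprovement_of_ge`), so N″(Λ, θ) ⟺ N″(Λ)** — the parameter carries
content exactly on `θ < 1/16`, where the census says the perturbative mechanism needs it. -/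
theorem nonlinearTransferOsc_iff_exact_of_ge {Λ θ : ℝ} (hθ : 1 / 16 ≤ θ) : NonlinearTransferOsc Λ θ ↔ NonlinearTransferExact Λ :=
  ⟨fun h => nonlinearTransferExact_of_osc h (oscillationImprovement_of_ge hθ), fun h => nonlinearTransferOsc_of_exact h θ⟩

/-- **the skeleton `L1′♮(Λ) ⟸ L ∧ N″(Λ, θ) ∧ OscillationImprovement θ`** (any θ). -/
theorem doorPeriodic_of_osc_pieces {Λ θ : ℝ} (hL : LatticeLiouvilleCert) (hN : NonlinearTransferOsc Λ θ)
    (hB : OscillationImprovement θ) : DoorPeriodic Λ :=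
  doorPeriodic_of_osc (hN hL) hB

/-- **the full chain at Λ₀ = 2 and any oscillation literal θ:
L1′♮(2) ⟸ LJDecay ∧ LJMoments ∧ CleanCrystalStability ∧ N″(2, θ) ∧ OscillationImprovement θ**. -/
theorem doorPeriodic_of_pieces_osc {θ : ℝ} (hD : LJDecay) (hM : LJMoments) (hC : CleanCrystalStability) (hN : NonlinearTransferOsc 2 θ)
    (hB : OscillationImprovement θ) : DoorPeriodic 2 :=
  doorPeriodic_of_osc_pieces (latticeLiouvilleCert_of (latticeLinLiouville_of hD hM) hC) hN hB

/-- ★ **THE (β) COLUMN OF RECORD, PERTURBATIVE BRANCH, FROM SIX TYPED LEAVES** (critic rows 408 / 414 (1)(d) / 416 (4); tree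
`gap_and_pert_1_50_of_periodic` discharges the door by name): for any oscillation literal `θ`,
`LJDecay → LJMoments → CleanCrystalStability → NonlinearTransferOsc 2 θ → OscillationImprovement θ → PeriodicBulkGapDoor 2 →
VisibleGap (1/50) ∧ PertRegime (1/50)` — leaves: two TRUE·S/M (LJ tail), one certificate-class (TAG 138′ LAT13: supported), lens-2's transfer
N″(2, θ), lens-3's bootstrap (TAG 154), and HBG″ (⟸ lens-2's A♭ ∧ bridge B via the sibling node `HomCoercivityBD.periodicBulkGap_of_exactLayered`
and tree `periodicBulkGapDoor_of_periodicBulkGap`). -/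
theorem gap_and_pert_1_50_of_liouville_pieces_osc {θ : ℝ} (hD : LJDecay) (hM : LJMoments) (hC : CleanCrystalStability)
    (hN : NonlinearTransferOsc 2 θ) (hB : OscillationImprovement θ) (hG : PeriodicBulkGapDoor 2) :
    VisibleGap (1 / 50) ∧ PertRegime (1 / 50) :=
  gap_and_pert_1_50_of_periodic (doorPeriodic_of_pieces_osc hD hM hC hN hB) hG

/-- the same with the chart-free HBG″♭ `PeriodicBulkGap 2` (tree `gap_and_pert_1_50_of_periodic'`). -/
theorem gap_and_pert_1_50_of_liouville_pieces_osc' {θ : ℝ} (hD : LJDecay) (hM : LJMoments) (hC : CleanCrystalStability)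
    (hN : NonlinearTransferOsc 2 θ) (hB : OscillationImprovement θ) (hG : PeriodicBulkGap 2) :
    VisibleGap (1 / 50) ∧ PertRegime (1 / 50) :=
  gap_and_pert_1_50_of_periodic' (doorPeriodic_of_pieces_osc hD hM hC hN hB) hG

/-- ★ **at the census literal θ_osc = 1/32** (fcc CAMP window, row 414 (1)(d)). -/
theorem gap_and_pert_1_50_of_liouville_pieces_osc_32 (hD : LJDecay) (hM : LJMoments) (hC : CleanCrystalStability)
    (hN : NonlinearTransferOsc 2 (1 / 32)) (hB : OscillationImprovement (1 / 32)) (hG : PeriodicBulkGapDoor 2) :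
    VisibleGap (1 / 50) ∧ PertRegime (1 / 50) :=
  gap_and_pert_1_50_of_liouville_pieces_osc hD hM hC hN hB hG

/-- **consistency with §C′**: at the clean tolerance θ = 1/16 the six-leaf column collapses to the five-leaf one (bootstrap free). -/
theorem gap_and_pert_1_50_of_liouville_pieces_osc_16 (hD : LJDecay) (hM : LJMoments) (hC : CleanCrystalStability)
    (hN : NonlinearTransferOsc 2 (1 / 16)) (hG : PeriodicBulkGapDoor 2) : VisibleGap (1 / 50) ∧ PertRegime (1 / 50) :=
  gap_and_pert_1_50_of_liouville_pieces hD hM hC ((nonlinearTransferOsc_iff_exact_of_ge le_rfl).1 hN) hG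

end Summit.AtomisticToContinuum.Crystallization.Theorems.ChartedZeroExcessLayeredLatticeLiouville

end
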